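import Literature.Probability.Percolation.FourArmPivotalCut
import Literature.Probability.Percolation.ArmEventPivotalAnnuli
import Literature.Probability.Percolation.ArmEventsReimer
import HarnessLib

/-!
# Pivotal sites of the four-arm event: the local event and its probability (proofs only)

Topic `Literature/Probability/Percolation`; family `crit-perc`, statement **crit-perc.S16**
(`Literature.Probability.Percolation.triTheta_exponent`). Proofs only (no new definition, no new
named fact). Sequel of `FourArmPivotalCut.lean`: the third of W. Werner's "three annuli" around a
pivotal site `x` of the four-arm event (PCMI 2009, Lecture 6, §5, "Using differential inequalities
for the four arm event"), for the tree's order-free event `armEvent ![T,F,T,F] r₀ N = O₂ ∩ C₂`,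
following Nolin 2008, §6.2, proof of Thm. 27, Case 3 [arXiv 0711.4948: Thm. 26] — the event

  `E(v) := {∃ l' ∈ {1, …, l-2}, v ⇝⁴ ∂S_{2^{l'}}(v) and ∂S_{2^{l'+1}}(v) ⇝⁶ ∂S_{2^l}(v)}
            ∪ {v ⇝⁴ ∂S_{2^{l-1}}(v)}`

(four alternating arms up to the scale of the defect, six arms `BBWBBW` beyond it) and the bound

  `P(∂S_{2^{l'+1}} ⇝⁶ ∂S_{2^l}) ≤ P(∂S_{2^{l'+1}} ⇝⁴ ∂S_{2^l}) · P(∂S_{2^{l'+1}} ⇝^{BB} ∂S_{2^l})`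

"using Reimer's inequality".

## Contents

* `pivotalPlus_subset_local` — **the local event at a pivotal site where OPENING `v` creates the
  event**: for `l ≥ 1`, `r₀ + 2·2^l ≤ |v|_𝕋`, `|v|_𝕋 + 2·2^l ≤ N`, the translate `ω - v` lies in
  `Π₄(1, 2^{l-1}) ∪ Π₆(2, 2^l) ∪ ⋃_{1 ≤ l' < l} (Π₄(1, 2^{l'-1}) ∩ Π₆(2^{l'+1}, 2^l))`, where
  `Π₄ = armEvent ![T,F,T,F]`, `Π₆ = armEvent ![T,T,T,T,F,F]` (the scale `l'` is that of the
  defect `P` of `exists_cut_of_pivotal_plus`: `2^{l'} ≤ |P - v|_𝕋 < 2^{l'+1}`; the four arms by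
  `relabel_shift_mem_armEvent_four_of_cut` at `d = 2^{l'-1}`, the six arms by
  `relabel_shift_mem_armEvent_six_of_cut` at `r' = 2^{l'+1}`, so that the outer radius of the
  former and the inner radius of the latter differ by the factor `4` of Werner's
  quasi-multiplicativity, Cor. 6.2);
* `pivotalMinus_subset_local` — the same where CLOSING `v` creates the event, with all colours
  exchanged (complementation);
* `real_armEvent_six_le` — Reimer: `P_t(Π₆ᶜ(r, R)) ≤ π̂_t(r, R) · P_t(armEvent ![c] r R)` for the
  six-arm event `![c,c,c,c,!c,!c]` of either colour (`real_armEvent_append_le_mul`,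
  `ArmEventsReimer.lean`, and dropping one of the two extra arms);
* `measureReal_pivotalPlus_le`, `measureReal_pivotalMinus_le`, `measureReal_isPivotal_fourArm_le`
  — **the probability estimate**: with the inner and outer annuli of
  `ArmEventPivotalAnnuli.lean` (`R₁ + 2^l < |v|_𝕋 < R₂ - 2^l`),
  `P_t(v pivotal for armEvent ![T,F,T,F] r₀ N) ≤ π̂_t(r₀, R₁) · π̂_t(R₂, N) · Σ_c L_c`,
  `L_c = π̂_t(1, 2^{l-1}) + P_t(Π₆ᶜ(2, 2^l)) + Σ_{1 ≤ l' < l} π̂_t(1, 2^{l'-1}) P_t(Π₆ᶜ(2^{l'+1}, 2^l))`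
  (independence of events determined by disjoint site sets, translation invariance, union bound).

The summation over `v` with quasi-multiplicativity and the a priori bounds (Werner's
`Σ_x π̂(‖x‖/2) ≤ c n² π̂(n)`) is the next step.

## References

* P. Nolin, Near-critical percolation in two dimensions, *Electron. J. Probab.* 13 (2008), §6.2,
  proof of Thm. 27, Case 3 [arXiv 0711.4948: Thm. 26] [Nolin2008].
* W. Werner, *Lectures on two-dimensional critical percolation*, IAS/Park City Math. Ser. 16
  (2009), Lecture 6, §5 [WernerPCMI2009].
* D. Reimer, Proof of the van den Berg–Kesten conjecture, *Combin. Probab. Comput.* 9 (2000)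
  [ReimerCPC2000].

Tree: `exists_cut_of_pivotal_plus`, `relabel_shift_mem_armEvent_four_of_cut`,
`relabel_shift_mem_armEvent_six_of_cut`, `armEvent_four_eq_inter` (`FourArmPivotalCut.lean`),
`isPivotal_armEvent_subset_inner/outer` (`ArmEventPivotalAnnuli.lean`),
`real_armEvent_append_le_mul` (`ArmEventsReimer.lean`), `armEvent_subset_armEvent_comp`,
`compl_preimage_armEvent`, `determinedBy_armEvent` (`ArmEventsStructure.lean`),
`determinedBy_preimage_relabel` (`TriShiftedCrossings.lean`), `sitePercolation_real_inter_of_disjoint`,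
`sitePercolation_real_preimage_relabel` (`SitePercolationMeasure.lean`), `fourArmProbAt`
(`WernerPivotalEstimates.lean`), `one_le_triNorm_sub_of_ne` (`ParaPivotalArms.lean`).
-/

noncomputable section

open MeasureTheory Set

namespace Literature.Probability.Percolation

open LatticeModels

/-! ### Colour bookkeeping -/

/-- The alternating four-arm colour sequence starting with `c`. [folklore] -/
theorem altFour_eq (c : Bool) :
    (fun j : Fin 4 => ![c, !c, c, !c] j) = if c then ![true, false, true, false]
      else ![false, true, false, true] := by
  cases c <;> rfl

/-- `armEvent ![F,T,F,T] = armEvent ![T,F,T,F]` (no cyclic order in `armEvent`: relabel the arms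
by the rotation `j ↦ j + 1`). [cite: SmirnovWernerMRL2001, §3] -/
theorem armEvent_ftft_eq (r R : ℕ) :
    armEvent ![false, true, false, true] r R = armEvent ![true, false, true, false] r R := by
  refine Subset.antisymm ?_ ?_
  · have h := armEvent_subset_armEvent_comp ![false, true, false, true] r R
      (e := ![1, 2, 3, 0]) (by decide)
    have e : (![false, true, false, true] ∘ ![(1 : Fin 4), 2, 3, 0]) =
        ![true, false, true, false] := by funext i; fin_cases i <;> rfl
    rwa [e] at h
  · have h := armEvent_subset_armEvent_comp ![true, false, true, false] r R
      (e := ![1, 2, 3, 0]) (by decide)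
    have e : (![true, false, true, false] ∘ ![(1 : Fin 4), 2, 3, 0]) =
        ![false, true, false, true] := by funext i; fin_cases i <;> rfl
    rwa [e] at h

/-- The alternating four-arm event of either starting colour is the tree's four-arm event.
[cite: SmirnovWernerMRL2001, §3] -/
theorem armEvent_altFour_eq (c : Bool) (r R : ℕ) :
    armEvent ![c, !c, c, !c] r R = armEvent ![true, false, true, false] r R := by
  cases c
  · exact armEvent_ftft_eq r R
  · rfl

/-- Complementation flips the colours of the alternating four-arm event (and so preserves the
tree's four-arm event). [cite: SmirnovWernerMRL2001, Rem. 2] -/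
theorem compl_mem_armEvent_four_iff {r R : ℕ} {ω : SiteConfig (Site 2)} :
    ωᶜ ∈ armEvent ![true, false, true, false] r R ↔ ω ∈ armEvent ![true, false, true, false] r R := by
  have h := compl_preimage_armEvent ![true, false, true, false] r R
  have e : (fun j => !(![true, false, true, false] : Fin 4 → Bool) j) = ![false, true, false, true] := by
    funext i; fin_cases i <;> rfl
  rw [e, armEvent_ftft_eq] at h
  exact Set.ext_iff.1 h ω

/-- Complementation flips the colours of the six-arm event `![c,c,c,c,!c,!c]`. [cite: SmirnovWernerMRL2001, Rem. 2] -/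
theorem compl_mem_armEvent_six_iff (c : Bool) {r R : ℕ} {ω : SiteConfig (Site 2)} :
    ωᶜ ∈ armEvent ![c, c, c, c, !c, !c] r R ↔ ω ∈ armEvent ![!c, !c, !c, !c, c, c] r R := by
  have h := compl_preimage_armEvent ![c, c, c, c, !c, !c] r R
  have e : (fun j => !(![c, c, c, c, !c, !c] : Fin 6 → Bool) j) = ![!c, !c, !c, !c, c, c] := by
    funext i; fin_cases i <;> simp
  rw [e] at h
  exact Set.ext_iff.1 h ω

/-- Complementation flips the colours of the alternating four-arm event `![c,!c,c,!c]`. [cite: SmirnovWernerMRL2001, Rem. 2] -/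
theorem compl_mem_armEvent_altFour_iff (c : Bool) {r R : ℕ} {ω : SiteConfig (Site 2)} :
    ωᶜ ∈ armEvent ![c, !c, c, !c] r R ↔ ω ∈ armEvent ![!c, !!c, !c, !!c] r R := by
  have h := compl_preimage_armEvent ![c, !c, c, !c] r R
  have e : (fun j => !(![c, !c, c, !c] : Fin 4 → Bool) j) = ![!c, !!c, !c, !!c] := by
    funext i; fin_cases i <;> simp
  rw [e] at h
  exact Set.ext_iff.1 h ω

/-! ### Reimer: six arms cost four arms times one arm -/

/-- The six-arm event `![c,c,c,c,!c,!c]` is contained in the event of the four alternating arms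
`![c,!c,c,!c]` followed by two further arms `![c,c]` (re-indexing; no cyclic order). [cite: Nolin2008, §4.1] -/
theorem armEvent_six_subset_append (c : Bool) (r R : ℕ) :
    armEvent ![c, c, c, c, !c, !c] r R ⊆ armEvent (Fin.append ![c, !c, c, !c] ![c, c]) r R := by
  have h := armEvent_subset_armEvent_comp ![c, c, c, c, !c, !c] r R
    (e := ![0, 4, 1, 5, 2, 3]) (by decide)
  have e : (![c, c, c, c, !c, !c] ∘ ![(0 : Fin 6), 4, 1, 5, 2, 3]) =
      Fin.append ![c, !c, c, !c] ![c, c] := by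
    funext i; fin_cases i <;> rfl
  rwa [e] at h

/-- **Six arms cost four arms times one arm** (Nolin 2008, §6.2, proof of Thm. 27, Case 3:
"`P(∂S ⇝^{6,σ'₆} ∂S) ≤ P(∂S ⇝^{4,σ₄} ∂S) P(∂S ⇝^{BB} ∂S)` … using Reimer's inequality"): for
`r ≤ R`, either colour `c` and every `t`,
`P_t(armEvent ![c,c,c,c,!c,!c] r R) ≤ π̂_t(r, R) · P_t(armEvent ![c] r R)`
(`real_armEvent_append_le_mul`, then one of the two extra arms is dropped). [cite: Nolin2008, §6.2, proof of Thm. 27, Case 3 (arXiv 0711.4948: Thm. 26)] [cite: ReimerCPC2000, main theorem] -/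
theorem real_armEvent_six_le (t : unitInterval) (c : Bool) {r R : ℕ} (hrR : r ≤ R) :
    (triSitePercolation t).real (armEvent ![c, c, c, c, !c, !c] r R) ≤
      fourArmProbAt t r R * (triSitePercolation t).real (armEvent ![c] r R) := by
  have h1 := real_armEvent_append_le_mul t ![c, !c, c, !c] ![c, c] hrR
  have h2 : (triSitePercolation t).real (armEvent ![c, c] r R) ≤
      (triSitePercolation t).real (armEvent ![c] r R) := by
    refine measureReal_mono ?_ (measure_ne_top _ _)
    have h := armEvent_subset_armEvent_comp ![c, c] r R (e := ![(0 : Fin 2)])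
      (fun i j _ => Subsingleton.elim i j)
    have e : (![c, c] ∘ ![(0 : Fin 2)]) = ![c] := by funext i; fin_cases i; rfl
    rwa [e] at h
  have h4 : (triSitePercolation t).real (armEvent ![c, !c, c, !c] r R) = fourArmProbAt t r R := by
    rw [fourArmProbAt, armEvent_altFour_eq]
  calc (triSitePercolation t).real (armEvent ![c, c, c, c, !c, !c] r R)
      ≤ (triSitePercolation t).real (armEvent (Fin.append ![c, !c, c, !c] ![c, c]) r R) :=
        measureReal_mono (armEvent_six_subset_append c r R) (measure_ne_top _ _)
    _ ≤ (triSitePercolation t).real (armEvent ![c, !c, c, !c] r R) *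
          (triSitePercolation t).real (armEvent ![c, c] r R) := h1
    _ ≤ fourArmProbAt t r R * (triSitePercolation t).real (armEvent ![c] r R) := by
        rw [h4]
        exact mul_le_mul_of_nonneg_left h2 (fourArmProbAt_nonneg t r R)

/-! ### The local event at a pivotal site -/

section Local

variable {r₀ N l : ℕ} {v : Site 2}

/-- **The local event where opening `v` creates the four-arm event** (Nolin 2008, §6.2, proof of
Thm. 27, Case 3, the event `E(v)`; Werner 2009, Lecture 6, §5). Let `l ≥ 1`,
`r₀ + 2·2^l ≤ |v|_𝕋`, `|v|_𝕋 + 2·2^l ≤ N`, and suppose `ω ∪ {v} ∈ armEvent ![T,F,T,F] r₀ N ∌ ω ∖ {v}`.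
With `P` the defect of `exists_cut_of_pivotal_plus` and `ρ = |P - v|_𝕋 ≥ 1`: if `ρ > 2^{l-1}` then
`ω - v` has four alternating arms across `Λ_{2^{l-1}} ∖ Λ₁` (`relabel_shift_mem_armEvent_four_of_cut`);
otherwise `2^{l'} ≤ ρ < 2^{l'+1}` with `l' ≤ l - 1`, and `ω - v` has six arms `TTTTFF` across
`Λ_{2^l} ∖ Λ_{2^{l'+1}}` (`relabel_shift_mem_armEvent_six_of_cut`) and, if `l' ≥ 1`, four alternating
arms across `Λ_{2^{l'-1}} ∖ Λ₁`. [cite: Nolin2008, §6.2, proof of Thm. 27, Case 3 (arXiv 0711.4948: Thm. 26, event E(v))] [cite: WernerPCMI2009, Lecture 6, §5 ("the three annuli")] -/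
theorem pivotalPlus_subset_local (hl : 1 ≤ l) (hvr : (r₀ : ℤ) + 2 * 2 ^ l ≤ triNorm v)
    (hvN : triNorm v + 2 * 2 ^ l ≤ N) {ω : SiteConfig (Site 2)}
    (hplus : insert v ω ∈ armEvent ![true, false, true, false] r₀ N)
    (hminus : ω \ {v} ∉ armEvent ![true, false, true, false] r₀ N) :
    SiteConfig.relabel (triShiftIso (-v)).toEquiv ω ∈
      (armEvent ![true, false, true, false] 1 (2 ^ (l - 1)) ∪
        armEvent ![true, true, true, true, false, false] 2 (2 ^ l)) ∪
        ⋃ l' ∈ Finset.Ico 1 l, (armEvent ![true, false, true, false] 1 (2 ^ (l' - 1)) ∩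
          armEvent ![true, true, true, true, false, false] (2 ^ (l' + 1)) (2 ^ l)) := by
  -- powers of two, as integer atoms
  obtain ⟨M, hM⟩ : ∃ M : ℕ, M = 2 ^ l := ⟨_, rfl⟩
  obtain ⟨M', hM'⟩ : ∃ M' : ℕ, M' = 2 ^ (l - 1) := ⟨_, rfl⟩
  have hMM' : M = 2 * M' := by
    rw [hM, hM']
    obtain ⟨k, rfl⟩ : ∃ k, l = k + 1 := ⟨l - 1, by omega⟩
    rw [Nat.add_sub_cancel, pow_succ]; ring
  have hM'1 : 1 ≤ M' := by rw [hM']; exact Nat.one_le_two_pow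
  have hvr' : (r₀ : ℤ) + 2 * M ≤ triNorm v := by rw [hM]; exact_mod_cast hvr
  have hvN' : triNorm v + 2 * M ≤ N := by rw [hM]; exact_mod_cast hvN
  have hr : (r₀ : ℤ) < triNorm v := by omega
  have hN : triNorm v < N := by omega
  obtain ⟨x₁, y₁, x₂, y₂, P, o₁, o₂, hx₁, hy₁, hx₂, hy₂, ho₁p, ho₂p, ho₁a, -, hvo₁, ho₁ω, ho₂ω,
    hdj, hPo₂, hcut⟩ := exists_cut_of_pivotal_plus hr hN hplus hminus
  have hPo₁ : P ∉ o₁.support := fun h => hdj P h hPo₂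
  have hPv : P ≠ v := (ho₂ω P hPo₂).2
  have hρ1 : 1 ≤ triNorm (P - v) := one_le_triNorm_sub_of_ne hPv
  by_cases hfar : (M' : ℤ) < triNorm (P - v)
  · -- four alternating arms up to `2^(l-1)`
    refine mem_union_left _ (mem_union_left _ ?_)
    rw [← hM']
    exact relabel_shift_mem_armEvent_four_of_cut o₁ hM'1 (by omega) (by omega) hx₁ hy₁ ho₁a ho₁ω
      hPo₁ hcut hfar
  · -- the dyadic scale `l'` of the defect
    push Not at hfar
    set n : ℕ := (triNorm (P - v)).toNat with hn
    have hnρ : (n : ℤ) = triNorm (P - v) := Int.toNat_of_nonneg (by omega)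
    have hn0 : n ≠ 0 := by intro h; rw [h] at hnρ; omega
    set l' : ℕ := Nat.log 2 n with hl'
    have h1 : 2 ^ l' ≤ n := Nat.pow_log_le_self 2 hn0
    have h2 : n < 2 ^ (l' + 1) := Nat.lt_pow_succ_log_self (by norm_num) n
    have hnM' : n ≤ M' := by
      have : (n : ℤ) ≤ M' := by omega
      exact_mod_cast this
    have hl'l : l' + 1 ≤ l := by
      have h3 : 2 ^ l' ≤ 2 ^ (l - 1) := by rw [← hM']; exact h1.trans hnM'
      have h4 : l' ≤ l - 1 := (Nat.pow_le_pow_iff_right (by norm_num)).1 h3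
      omega
    -- six arms from `2^(l'+1)` to `2^l`
    have hsix : SiteConfig.relabel (triShiftIso (-v)).toEquiv ω ∈
        armEvent ![true, true, true, true, false, false] (2 ^ (l' + 1)) (2 ^ l) := by
      have hM1 : 1 ≤ M := by omega
      have h := relabel_shift_mem_armEvent_six_of_cut (R := M) (r' := 2 ^ (l' + 1)) o₁ o₂ hM1
        hvr' hvN' Nat.one_le_two_pow (by rw [hM]; exact Nat.pow_le_pow_right (by norm_num) hl'l)
        (by rw [← hnρ]; exact_mod_cast h2) hx₁ hy₁ hx₂ hy₂ ho₁p ho₂p ho₁a hvo₁ ho₁ω ho₂ω hdj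
        hPo₂ hcut
      rwa [hM] at h
    by_cases hl'0 : l' = 0
    · refine mem_union_left _ (mem_union_right _ ?_)
      rw [hl'0, zero_add, pow_one] at hsix
      exact hsix
    · -- four alternating arms up to `2^(l'-1)`
      refine mem_union_right _ (mem_iUnion₂.2 ⟨l', Finset.mem_Ico.2 ⟨by omega, by omega⟩, ?_, hsix⟩)
      have hd1 : 1 ≤ 2 ^ (l' - 1) := Nat.one_le_two_pow
      have hdlt : 2 ^ (l' - 1) < n := by
        have : 2 ^ (l' - 1) < 2 ^ l' := Nat.pow_lt_pow_right (by norm_num) (by omega)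
        omega
      have hdM : 2 * 2 ^ (l' - 1) ≤ M := by
        have : 2 ^ (l' - 1) ≤ M' := by omega
        omega
      refine relabel_shift_mem_armEvent_four_of_cut o₁ hd1 ?_ ?_ hx₁ hy₁ ho₁a ho₁ω hPo₁ hcut ?_
      · have : (2 : ℤ) * ((2 ^ (l' - 1) : ℕ) : ℤ) ≤ M := by exact_mod_cast hdM
        omega
      · have : (2 : ℤ) * ((2 ^ (l' - 1) : ℕ) : ℤ) ≤ M := by exact_mod_cast hdM
        omega
      · rw [← hnρ]; exact_mod_cast hdlt

/-- `SiteConfig.relabel` commutes with complementation. [folklore] -/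
theorem relabel_compl {V W : Type*} (e : V ≃ W) (ω : SiteConfig V) :
    SiteConfig.relabel e ωᶜ = (SiteConfig.relabel e ω)ᶜ := by
  ext w
  simp

/-- **The local event where closing `v` creates the four-arm event**: the statement of
`pivotalPlus_subset_local` with all colours exchanged, by complementation (`ω ↦ ωᶜ` exchanges
`ω ∪ {v}` and `ω ∖ {v}`, preserves the four-arm event and flips the colours of the arm events).
[cite: Nolin2008, §6.2, proof of Thm. 27, Case 3 (arXiv 0711.4948: Thm. 26, "the second term of the sum")] -/
theorem pivotalMinus_subset_local (hl : 1 ≤ l) (hvr : (r₀ : ℤ) + 2 * 2 ^ l ≤ triNorm v)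
    (hvN : triNorm v + 2 * 2 ^ l ≤ N) {ω : SiteConfig (Site 2)}
    (hminus : ω \ {v} ∈ armEvent ![true, false, true, false] r₀ N)
    (hplus : insert v ω ∉ armEvent ![true, false, true, false] r₀ N) :
    SiteConfig.relabel (triShiftIso (-v)).toEquiv ω ∈
      (armEvent ![false, true, false, true] 1 (2 ^ (l - 1)) ∪
        armEvent ![false, false, false, false, true, true] 2 (2 ^ l)) ∪
        ⋃ l' ∈ Finset.Ico 1 l, (armEvent ![false, true, false, true] 1 (2 ^ (l' - 1)) ∩
          armEvent ![false, false, false, false, true, true] (2 ^ (l' + 1)) (2 ^ l)) := by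
  -- apply the "plus" statement to `ωᶜ`
  have hins : insert v ωᶜ = (ω \ {v})ᶜ := by
    ext z; simp [mem_insert_iff]; tauto
  have hdiff : ωᶜ \ {v} = (insert v ω)ᶜ := by
    ext z; simp [mem_insert_iff]; tauto
  have hplus' : insert v ωᶜ ∈ armEvent ![true, false, true, false] r₀ N := by
    rw [hins, compl_mem_armEvent_four_iff]; exact hminus
  have hminus' : ωᶜ \ {v} ∉ armEvent ![true, false, true, false] r₀ N := by
    rw [hdiff, compl_mem_armEvent_four_iff]; exact hplus
  have h := pivotalPlus_subset_local hl hvr hvN hplus' hminus'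
  rw [relabel_compl] at h
  set ξ := SiteConfig.relabel (triShiftIso (-v)).toEquiv ω with hξ
  have e4 : ∀ {r R : ℕ}, ξᶜ ∈ armEvent ![true, false, true, false] r R ↔
      ξ ∈ armEvent ![false, true, false, true] r R := fun {r R} =>
    compl_mem_armEvent_altFour_iff true
  have e6 : ∀ {r R : ℕ}, ξᶜ ∈ armEvent ![true, true, true, true, false, false] r R ↔
      ξ ∈ armEvent ![false, false, false, false, true, true] r R := fun {r R} =>
    compl_mem_armEvent_six_iff true
  simp only [mem_union, mem_iUnion, mem_inter_iff, exists_prop] at h ⊢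
  rcases h with (h | h) | ⟨l', hl', h₁, h₂⟩
  · exact Or.inl (Or.inl (e4.1 h))
  · exact Or.inl (Or.inr (e6.1 h))
  · exact Or.inr ⟨l', hl', e4.1 h₁, e6.1 h₂⟩

end Local

/-! ### The probability estimate -/

section Bound

variable {r₀ N l R₁ R₂ : ℕ} {v : Site 2}

/-- The translate to `v` of an arm event is determined by the sites of the translated annulus
(general number of arms; the tree's `determinedBy_preimage_shift_armEvent` is `k = 4`). [folklore] -/
theorem determinedBy_preimage_shift_armEvent' {k : ℕ} (κ : Fin k → Bool) {r d : ℕ} (hrd : r ≤ d)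
    (v : Site 2) :
    DeterminedBy (SiteConfig.relabel (triShiftIso (-v)).toEquiv ⁻¹' armEvent κ r d)
      (↑((triAnnulus r d).image fun u => u + v) : Set (Site 2)) := by
  have h := determinedBy_preimage_relabel (triShiftIso (-v)).toEquiv (determinedBy_armEvent κ hrd)
  rw [Finset.coe_image]
  convert h using 1
  ext z
  simp only [Set.mem_image, Finset.mem_coe]
  constructor
  · rintro ⟨u, hu, rfl⟩
    refine ⟨u, hu, ?_⟩
    apply (triShiftIso (-v)).toEquiv.injective
    rw [Equiv.apply_symm_apply]
    show u = triShiftIso (-v) (u + v)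
    simp
  · rintro ⟨u, hu, rfl⟩
    refine ⟨u, hu, ?_⟩
    apply (triShiftIso (-v)).toEquiv.injective
    rw [Equiv.apply_symm_apply]
    show triShiftIso (-v) (u + v) = u
    simp

/-- **One local term**: for events `B₁`, `B₂` determined by `Λ_d(v)`-translates of two disjoint
annuli inside `Λ_{2^l}`, and the inner / outer arm events,
`P_t(A_in ∩ A_out ∩ v+(B₁ ∩ B₂)) = P_t(A_in) P_t(A_out) P_t(B₁) P_t(B₂)` — independence of events
determined by disjoint site sets and translation invariance; here in the inequality form that is
used, for the translates of `Π₄(1, d)` and `Π₆(r', R)` with `d < r'`. [cite: Nolin2008, §6.2, proof of Thm. 27 ("by independence of the three events")] -/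
theorem measureReal_inner_outer_local_le (t : unitInterval) {κ₄ : Fin 4 → Bool} {κ₆ : Fin 6 → Bool}
    {d r' R : ℕ} (hd : 1 ≤ d) (hdr : d < r') (hr'R : r' ≤ R) (hR₀ : r₀ ≤ R₁)
    (hR₁v : (R₁ : ℤ) + R < triNorm v) (hR₂v : triNorm v + R < R₂) (hR₂N : R₂ ≤ N) :
    (triSitePercolation t).real
        (armEvent ![true, false, true, false] r₀ R₁ ∩ armEvent ![true, false, true, false] R₂ N ∩
          SiteConfig.relabel (triShiftIso (-v)).toEquiv ⁻¹' (armEvent κ₄ 1 d ∩ armEvent κ₆ r' R)) =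
      fourArmProbAt t r₀ R₁ * fourArmProbAt t R₂ N *
        ((triSitePercolation t).real (armEvent κ₄ 1 d) *
          (triSitePercolation t).real (armEvent κ₆ r' R)) := by
  classical
  set e := (triShiftIso (-v)).toEquiv with he
  set A : Set (SiteConfig (Site 2)) := armEvent ![true, false, true, false] r₀ R₁ with hA
  set C : Set (SiteConfig (Site 2)) := armEvent ![true, false, true, false] R₂ N with hC
  set B₁ : Set (SiteConfig (Site 2)) := SiteConfig.relabel e ⁻¹' armEvent κ₄ 1 d with hB₁
  set B₂ : Set (SiteConfig (Site 2)) := SiteConfig.relabel e ⁻¹' armEvent κ₆ r' R with hB₂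
  set F : Finset (Site 2) := triAnnulus r₀ R₁ with hF
  set H : Finset (Site 2) := triAnnulus R₂ N with hH
  set G₁ : Finset (Site 2) := (triAnnulus 1 d).image fun u => u + v with hG₁
  set G₂ : Finset (Site 2) := (triAnnulus r' R).image fun u => u + v with hG₂
  have hAF : DeterminedBy A ↑F := determinedBy_armEvent _ (by omega)
  have hCH : DeterminedBy C ↑H := determinedBy_armEvent _ hR₂N
  have hBG₁ : DeterminedBy B₁ ↑G₁ := determinedBy_preimage_shift_armEvent' κ₄ hd v
  have hBG₂ : DeterminedBy B₂ ↑G₂ := determinedBy_preimage_shift_armEvent' κ₆ hr'R v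
  have hG₁mem : ∀ z ∈ G₁, triNorm v - d ≤ triNorm z ∧ triNorm z ≤ triNorm v + d ∧
      (1 : ℤ) ≤ triNorm (z - v) ∧ triNorm (z - v) ≤ d := by
    intro z hz
    rw [hG₁, Finset.mem_image] at hz
    obtain ⟨u, hu, rfl⟩ := hz
    rw [mem_triAnnulus] at hu
    have h1 := triNorm_add_le u v
    have h2 := triNorm_add_le (u + v) (-u)
    rw [add_neg_cancel_comm, triNorm_neg] at h2
    rw [add_sub_cancel_right]
    push_cast at hu
    omega
  have hG₂mem : ∀ z ∈ G₂, triNorm v - R ≤ triNorm z ∧ triNorm z ≤ triNorm v + R ∧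
      (r' : ℤ) ≤ triNorm (z - v) ∧ triNorm (z - v) ≤ R := by
    intro z hz
    rw [hG₂, Finset.mem_image] at hz
    obtain ⟨u, hu, rfl⟩ := hz
    rw [mem_triAnnulus] at hu
    have h1 := triNorm_add_le u v
    have h2 := triNorm_add_le (u + v) (-u)
    rw [add_neg_cancel_comm, triNorm_neg] at h2
    rw [add_sub_cancel_right]
    omega
  have hdR : (d : ℤ) ≤ R := by exact_mod_cast (show d ≤ R by omega)
  have hFG₁ : Disjoint F G₁ := Finset.disjoint_left.2 fun z hzF hzG => by
    rw [hF, mem_triAnnulus] at hzF; have := (hG₁mem z hzG).1; omega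
  have hFG₂ : Disjoint F G₂ := Finset.disjoint_left.2 fun z hzF hzG => by
    rw [hF, mem_triAnnulus] at hzF; have := (hG₂mem z hzG).1; omega
  have hFH : Disjoint F H := Finset.disjoint_left.2 fun z hzF hzH => by
    rw [hF, mem_triAnnulus] at hzF; rw [hH, mem_triAnnulus] at hzH; omega
  have hG₁H : Disjoint G₁ H := Finset.disjoint_left.2 fun z hzG hzH => by
    rw [hH, mem_triAnnulus] at hzH; have := (hG₁mem z hzG).2.1; omega
  have hG₂H : Disjoint G₂ H := Finset.disjoint_left.2 fun z hzG hzH => by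
    rw [hH, mem_triAnnulus] at hzH; have := (hG₂mem z hzG).2.1; omega
  have hG₁G₂ : Disjoint G₁ G₂ := Finset.disjoint_left.2 fun z hz₁ hz₂ => by
    have h1 := (hG₁mem z hz₁).2.2.2; have h2 := (hG₂mem z hz₂).2.2.1; omega
  -- independence
  have hB : DeterminedBy (B₁ ∩ B₂) ↑(G₁ ∪ G₂) :=
    (hBG₁.mono (by rw [Finset.coe_union]; exact subset_union_left)).inter
      (hBG₂.mono (by rw [Finset.coe_union]; exact subset_union_right))
  have hAC : DeterminedBy (A ∩ C) ↑(F ∪ H) :=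
    (hAF.mono (by rw [Finset.coe_union]; exact subset_union_left)).inter
      (hCH.mono (by rw [Finset.coe_union]; exact subset_union_right))
  have hdisj : Disjoint (F ∪ H) (G₁ ∪ G₂) := by
    rw [Finset.disjoint_union_left, Finset.disjoint_union_right, Finset.disjoint_union_right]
    exact ⟨⟨hFG₁, hFG₂⟩, hG₁H.symm, hG₂H.symm⟩
  have h1 : (triSitePercolation t).real (A ∩ C ∩ (B₁ ∩ B₂)) =
      (triSitePercolation t).real (A ∩ C) * (triSitePercolation t).real (B₁ ∩ B₂) :=
    sitePercolation_real_inter_of_disjoint t hAC hB hdisj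
  have h2 : (triSitePercolation t).real (A ∩ C) =
      (triSitePercolation t).real A * (triSitePercolation t).real C :=
    sitePercolation_real_inter_of_disjoint t hAF hCH hFH
  have h3 : (triSitePercolation t).real (B₁ ∩ B₂) =
      (triSitePercolation t).real B₁ * (triSitePercolation t).real B₂ :=
    sitePercolation_real_inter_of_disjoint t hBG₁ hBG₂ hG₁G₂
  have h4 : (triSitePercolation t).real B₁ = (triSitePercolation t).real (armEvent κ₄ 1 d) := by
    rw [hB₁, triSitePercolation]; exact sitePercolation_real_preimage_relabel e t _
  have h5 : (triSitePercolation t).real B₂ = (triSitePercolation t).real (armEvent κ₆ r' R) := by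
    rw [hB₂, triSitePercolation]; exact sitePercolation_real_preimage_relabel e t _
  have hpre : SiteConfig.relabel e ⁻¹' (armEvent κ₄ 1 d ∩ armEvent κ₆ r' R) = B₁ ∩ B₂ := by
    rw [hB₁, hB₂, Set.preimage_inter]
  rw [hpre, h1, h2, h3, h4, h5]
  rfl

/-- **One local term with four arms only** (the case of no defect below `2^{l-1}`):
`P_t(A_in ∩ A_out ∩ v+Π₄(1, d)) = π̂_t(r₀, R₁) π̂_t(R₂, N) P_t(Π₄(1, d))`. [cite: Nolin2008, §6.2, proof of Thm. 27 ("by independence of the three events")] -/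
theorem measureReal_inner_outer_four_le (t : unitInterval) {κ₄ : Fin 4 → Bool} {d R : ℕ}
    (hd : 1 ≤ d) (hdR : d ≤ R) (hR₀ : r₀ ≤ R₁) (hR₁v : (R₁ : ℤ) + R < triNorm v)
    (hR₂v : triNorm v + R < R₂) (hR₂N : R₂ ≤ N) :
    (triSitePercolation t).real
        (armEvent ![true, false, true, false] r₀ R₁ ∩ armEvent ![true, false, true, false] R₂ N ∩
          SiteConfig.relabel (triShiftIso (-v)).toEquiv ⁻¹' armEvent κ₄ 1 d) =
      fourArmProbAt t r₀ R₁ * fourArmProbAt t R₂ N *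
        (triSitePercolation t).real (armEvent κ₄ 1 d) := by
  classical
  set e := (triShiftIso (-v)).toEquiv with he
  set A : Set (SiteConfig (Site 2)) := armEvent ![true, false, true, false] r₀ R₁ with hA
  set C : Set (SiteConfig (Site 2)) := armEvent ![true, false, true, false] R₂ N with hC
  set B₁ : Set (SiteConfig (Site 2)) := SiteConfig.relabel e ⁻¹' armEvent κ₄ 1 d with hB₁
  set F : Finset (Site 2) := triAnnulus r₀ R₁ with hF
  set H : Finset (Site 2) := triAnnulus R₂ N with hH
  set G₁ : Finset (Site 2) := (triAnnulus 1 d).image fun u => u + v with hG₁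
  have hAF : DeterminedBy A ↑F := determinedBy_armEvent _ (by omega)
  have hCH : DeterminedBy C ↑H := determinedBy_armEvent _ hR₂N
  have hBG₁ : DeterminedBy B₁ ↑G₁ := determinedBy_preimage_shift_armEvent' κ₄ hd v
  have hG₁mem : ∀ z ∈ G₁, triNorm v - d ≤ triNorm z ∧ triNorm z ≤ triNorm v + d := by
    intro z hz
    rw [hG₁, Finset.mem_image] at hz
    obtain ⟨u, hu, rfl⟩ := hz
    rw [mem_triAnnulus] at hu
    have h1 := triNorm_add_le u v
    have h2 := triNorm_add_le (u + v) (-u)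
    rw [add_neg_cancel_comm, triNorm_neg] at h2
    push_cast at hu
    omega
  have hdR' : (d : ℤ) ≤ R := by exact_mod_cast hdR
  have hFG₁ : Disjoint F G₁ := Finset.disjoint_left.2 fun z hzF hzG => by
    rw [hF, mem_triAnnulus] at hzF; have := (hG₁mem z hzG).1; omega
  have hFH : Disjoint F H := Finset.disjoint_left.2 fun z hzF hzH => by
    rw [hF, mem_triAnnulus] at hzF; rw [hH, mem_triAnnulus] at hzH; omega
  have hG₁H : Disjoint G₁ H := Finset.disjoint_left.2 fun z hzG hzH => by
    rw [hH, mem_triAnnulus] at hzH; have := (hG₁mem z hzG).2; omega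
  have hAC : DeterminedBy (A ∩ C) ↑(F ∪ H) :=
    (hAF.mono (by rw [Finset.coe_union]; exact subset_union_left)).inter
      (hCH.mono (by rw [Finset.coe_union]; exact subset_union_right))
  have hdisj : Disjoint (F ∪ H) G₁ := by
    rw [Finset.disjoint_union_left]; exact ⟨hFG₁, hG₁H.symm⟩
  have h1 : (triSitePercolation t).real (A ∩ C ∩ B₁) =
      (triSitePercolation t).real (A ∩ C) * (triSitePercolation t).real B₁ :=
    sitePercolation_real_inter_of_disjoint t hAC hBG₁ hdisj
  have h2 : (triSitePercolation t).real (A ∩ C) =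
      (triSitePercolation t).real A * (triSitePercolation t).real C :=
    sitePercolation_real_inter_of_disjoint t hAF hCH hFH
  have h4 : (triSitePercolation t).real B₁ = (triSitePercolation t).real (armEvent κ₄ 1 d) := by
    rw [hB₁, triSitePercolation]; exact sitePercolation_real_preimage_relabel e t _
  rw [h1, h2, h4]
  rfl

/-- **One local term with six arms only** (the case of a defect next to `v`):
`P_t(A_in ∩ A_out ∩ v+Π₆(r', R)) = π̂_t(r₀, R₁) π̂_t(R₂, N) P_t(Π₆(r', R))`. [cite: Nolin2008, §6.2, proof of Thm. 27 ("by independence of the three events")] -/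
theorem measureReal_inner_outer_six_le (t : unitInterval) {κ₆ : Fin 6 → Bool} {r' R : ℕ}
    (hr'R : r' ≤ R) (hR₀ : r₀ ≤ R₁) (hR₁v : (R₁ : ℤ) + R < triNorm v)
    (hR₂v : triNorm v + R < R₂) (hR₂N : R₂ ≤ N) :
    (triSitePercolation t).real
        (armEvent ![true, false, true, false] r₀ R₁ ∩ armEvent ![true, false, true, false] R₂ N ∩
          SiteConfig.relabel (triShiftIso (-v)).toEquiv ⁻¹' armEvent κ₆ r' R) =
      fourArmProbAt t r₀ R₁ * fourArmProbAt t R₂ N *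
        (triSitePercolation t).real (armEvent κ₆ r' R) := by
  classical
  set e := (triShiftIso (-v)).toEquiv with he
  set A : Set (SiteConfig (Site 2)) := armEvent ![true, false, true, false] r₀ R₁ with hA
  set C : Set (SiteConfig (Site 2)) := armEvent ![true, false, true, false] R₂ N with hC
  set B₂ : Set (SiteConfig (Site 2)) := SiteConfig.relabel e ⁻¹' armEvent κ₆ r' R with hB₂
  set F : Finset (Site 2) := triAnnulus r₀ R₁ with hF
  set H : Finset (Site 2) := triAnnulus R₂ N with hH
  set G₂ : Finset (Site 2) := (triAnnulus r' R).image fun u => u + v with hG₂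
  have hAF : DeterminedBy A ↑F := determinedBy_armEvent _ (by omega)
  have hCH : DeterminedBy C ↑H := determinedBy_armEvent _ hR₂N
  have hBG₂ : DeterminedBy B₂ ↑G₂ := determinedBy_preimage_shift_armEvent' κ₆ hr'R v
  have hG₂mem : ∀ z ∈ G₂, triNorm v - R ≤ triNorm z ∧ triNorm z ≤ triNorm v + R := by
    intro z hz
    rw [hG₂, Finset.mem_image] at hz
    obtain ⟨u, hu, rfl⟩ := hz
    rw [mem_triAnnulus] at hu
    have h1 := triNorm_add_le u v
    have h2 := triNorm_add_le (u + v) (-u)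
    rw [add_neg_cancel_comm, triNorm_neg] at h2
    omega
  have hFG₂ : Disjoint F G₂ := Finset.disjoint_left.2 fun z hzF hzG => by
    rw [hF, mem_triAnnulus] at hzF; have := (hG₂mem z hzG).1; omega
  have hFH : Disjoint F H := Finset.disjoint_left.2 fun z hzF hzH => by
    rw [hF, mem_triAnnulus] at hzF; rw [hH, mem_triAnnulus] at hzH; omega
  have hG₂H : Disjoint G₂ H := Finset.disjoint_left.2 fun z hzG hzH => by
    rw [hH, mem_triAnnulus] at hzH; have := (hG₂mem z hzG).2; omega
  have hAC : DeterminedBy (A ∩ C) ↑(F ∪ H) :=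
    (hAF.mono (by rw [Finset.coe_union]; exact subset_union_left)).inter
      (hCH.mono (by rw [Finset.coe_union]; exact subset_union_right))
  have hdisj : Disjoint (F ∪ H) G₂ := by
    rw [Finset.disjoint_union_left]; exact ⟨hFG₂, hG₂H.symm⟩
  have h1 : (triSitePercolation t).real (A ∩ C ∩ B₂) =
      (triSitePercolation t).real (A ∩ C) * (triSitePercolation t).real B₂ :=
    sitePercolation_real_inter_of_disjoint t hAC hBG₂ hdisj
  have h2 : (triSitePercolation t).real (A ∩ C) =
      (triSitePercolation t).real A * (triSitePercolation t).real C :=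
    sitePercolation_real_inter_of_disjoint t hAF hCH hFH
  have h5 : (triSitePercolation t).real B₂ = (triSitePercolation t).real (armEvent κ₆ r' R) := by
    rw [hB₂, triSitePercolation]; exact sitePercolation_real_preimage_relabel e t _
  rw [h1, h2, h5]
  rfl

/-- **The probability of the local event, given its shape** (union bound + independence): if a set
`S` of configurations lies in the inner and outer four-arm events and its translate by `-v` lies in
`Π₄ᶜ(1, 2^{l-1}) ∪ Π₆ᶜ(2, 2^l) ∪ ⋃_{1 ≤ l' < l} (Π₄ᶜ(1, 2^{l'-1}) ∩ Π₆ᶜ(2^{l'+1}, 2^l))` (colour `c`),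
then `P_t(S) ≤ π̂_t(r₀, R₁) π̂_t(R₂, N) L_c` with
`L_c = π̂_t(1, 2^{l-1}) + P_t(Π₆ᶜ(2, 2^l)) + Σ_{1 ≤ l' < l} π̂_t(1, 2^{l'-1}) P_t(Π₆ᶜ(2^{l'+1}, 2^l))`.
[cite: Nolin2008, §6.2, proof of Thm. 27, Case 3 (arXiv 0711.4948: Thm. 26)] -/
theorem measureReal_le_of_subset_local (t : unitInterval) (c : Bool) (hl : 1 ≤ l)
    (hR₀ : r₀ ≤ R₁) (hR₁v : (R₁ : ℤ) + 2 ^ l < triNorm v) (hR₂v : triNorm v + 2 ^ l < R₂)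
    (hR₂N : R₂ ≤ N) {S : Set (SiteConfig (Site 2))}
    (hin : S ⊆ armEvent ![true, false, true, false] r₀ R₁)
    (hout : S ⊆ armEvent ![true, false, true, false] R₂ N)
    (hloc : S ⊆ SiteConfig.relabel (triShiftIso (-v)).toEquiv ⁻¹'
      ((armEvent ![c, !c, c, !c] 1 (2 ^ (l - 1)) ∪ armEvent ![c, c, c, c, !c, !c] 2 (2 ^ l)) ∪
        ⋃ l' ∈ Finset.Ico 1 l, (armEvent ![c, !c, c, !c] 1 (2 ^ (l' - 1)) ∩
          armEvent ![c, c, c, c, !c, !c] (2 ^ (l' + 1)) (2 ^ l)))) :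
    (triSitePercolation t).real S ≤
      fourArmProbAt t r₀ R₁ * fourArmProbAt t R₂ N *
        (fourArmProbAt t 1 (2 ^ (l - 1)) +
          (triSitePercolation t).real (armEvent ![c, c, c, c, !c, !c] 2 (2 ^ l)) +
          ∑ l' ∈ Finset.Ico 1 l, fourArmProbAt t 1 (2 ^ (l' - 1)) *
            (triSitePercolation t).real (armEvent ![c, c, c, c, !c, !c] (2 ^ (l' + 1)) (2 ^ l))) := by
  classical
  set μ := triSitePercolation t with hμ
  set e := (triShiftIso (-v)).toEquiv with he
  set A := armEvent ![true, false, true, false] r₀ R₁ with hA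
  set C := armEvent ![true, false, true, false] R₂ N with hC
  set T₀ := SiteConfig.relabel e ⁻¹' armEvent ![c, !c, c, !c] 1 (2 ^ (l - 1)) with hT₀
  set T₁ := SiteConfig.relabel e ⁻¹' armEvent ![c, c, c, c, !c, !c] 2 (2 ^ l) with hT₁
  set T : ℕ → Set (SiteConfig (Site 2)) := fun l' => SiteConfig.relabel e ⁻¹'
    (armEvent ![c, !c, c, !c] 1 (2 ^ (l' - 1)) ∩
      armEvent ![c, c, c, c, !c, !c] (2 ^ (l' + 1)) (2 ^ l)) with hT
  have h2l : 2 ^ (l - 1) ≤ 2 ^ l := Nat.pow_le_pow_right (by norm_num) (by omega)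
  have h2l' : (1 : ℕ) ≤ 2 ^ (l - 1) := Nat.one_le_two_pow
  have h22 : 2 ≤ 2 ^ l := by
    calc 2 = 2 ^ 1 := by norm_num
      _ ≤ 2 ^ l := Nat.pow_le_pow_right (by norm_num) hl
  have hcast : ((2 ^ l : ℕ) : ℤ) = (2 : ℤ) ^ l := by push_cast; ring
  have hR₁v' : (R₁ : ℤ) + ((2 ^ l : ℕ) : ℤ) < triNorm v := by rw [hcast]; exact hR₁v
  have hR₂v' : triNorm v + ((2 ^ l : ℕ) : ℤ) < R₂ := by rw [hcast]; exact hR₂v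
  -- `S` inside the union of the pieces, each intersected with `A ∩ C`
  have hS : S ⊆ (A ∩ C ∩ T₀ ∪ A ∩ C ∩ T₁) ∪ ⋃ l' ∈ Finset.Ico 1 l, A ∩ C ∩ T l' := by
    intro ω hω
    have hAω := hin hω
    have hCω := hout hω
    have hL := hloc hω
    simp only [mem_preimage, mem_union, mem_iUnion, exists_prop] at hL
    rcases hL with (h | h) | ⟨l', hl', h⟩
    · exact mem_union_left _ (mem_union_left _ ⟨⟨hAω, hCω⟩, h⟩)
    · exact mem_union_left _ (mem_union_right _ ⟨⟨hAω, hCω⟩, h⟩)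
    · exact mem_union_right _ (mem_iUnion₂.2 ⟨l', hl', ⟨hAω, hCω⟩, h⟩)
  -- the four-arm probabilities of colour `c` are `fourArmProbAt`
  have h4 : ∀ r R : ℕ, μ.real (armEvent ![c, !c, c, !c] r R) = fourArmProbAt t r R := fun r R => by
    rw [hμ, fourArmProbAt, armEvent_altFour_eq]
  -- the pieces
  have e₀ : μ.real (A ∩ C ∩ T₀) = fourArmProbAt t r₀ R₁ * fourArmProbAt t R₂ N *
      fourArmProbAt t 1 (2 ^ (l - 1)) := by
    rw [hμ, hA, hC, hT₀, measureReal_inner_outer_four_le t h2l' h2l hR₀ hR₁v' hR₂v' hR₂N, ← hμ, h4]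
  have e₁ : μ.real (A ∩ C ∩ T₁) = fourArmProbAt t r₀ R₁ * fourArmProbAt t R₂ N *
      μ.real (armEvent ![c, c, c, c, !c, !c] 2 (2 ^ l)) := by
    rw [hμ, hA, hC, hT₁, measureReal_inner_outer_six_le t h22 hR₀ hR₁v' hR₂v' hR₂N]
  have e₂ : ∀ l' ∈ Finset.Ico 1 l, μ.real (A ∩ C ∩ T l') =
      fourArmProbAt t r₀ R₁ * fourArmProbAt t R₂ N *
        (fourArmProbAt t 1 (2 ^ (l' - 1)) *
          μ.real (armEvent ![c, c, c, c, !c, !c] (2 ^ (l' + 1)) (2 ^ l))) := by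
    intro l' hl'
    rw [Finset.mem_Ico] at hl'
    have hd : (1 : ℕ) ≤ 2 ^ (l' - 1) := Nat.one_le_two_pow
    have hdr : 2 ^ (l' - 1) < 2 ^ (l' + 1) := Nat.pow_lt_pow_right (by norm_num) (by omega)
    have hr'R : 2 ^ (l' + 1) ≤ 2 ^ l := Nat.pow_le_pow_right (by norm_num) (by omega)
    rw [hμ, hA, hC, hT]
    simp only
    rw [measureReal_inner_outer_local_le t hd hdr hr'R hR₀ hR₁v' hR₂v' hR₂N, ← hμ, h4]
  have hnn : 0 ≤ fourArmProbAt t r₀ R₁ * fourArmProbAt t R₂ N :=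
    mul_nonneg (fourArmProbAt_nonneg _ _ _) (fourArmProbAt_nonneg _ _ _)
  calc μ.real S ≤ μ.real ((A ∩ C ∩ T₀ ∪ A ∩ C ∩ T₁) ∪ ⋃ l' ∈ Finset.Ico 1 l, A ∩ C ∩ T l') :=
        measureReal_mono hS (measure_ne_top _ _)
    _ ≤ μ.real (A ∩ C ∩ T₀ ∪ A ∩ C ∩ T₁) + μ.real (⋃ l' ∈ Finset.Ico 1 l, A ∩ C ∩ T l') :=
        measureReal_union_le _ _
    _ ≤ (μ.real (A ∩ C ∩ T₀) + μ.real (A ∩ C ∩ T₁)) +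
          ∑ l' ∈ Finset.Ico 1 l, μ.real (A ∩ C ∩ T l') :=
        add_le_add (measureReal_union_le _ _) (measureReal_biUnion_finset_le _ _)
    _ = fourArmProbAt t r₀ R₁ * fourArmProbAt t R₂ N *
          (fourArmProbAt t 1 (2 ^ (l - 1)) + μ.real (armEvent ![c, c, c, c, !c, !c] 2 (2 ^ l)) +
            ∑ l' ∈ Finset.Ico 1 l, fourArmProbAt t 1 (2 ^ (l' - 1)) *
              μ.real (armEvent ![c, c, c, c, !c, !c] (2 ^ (l' + 1)) (2 ^ l))) := by
        rw [e₀, e₁, Finset.sum_congr rfl e₂, ← Finset.mul_sum]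
        ring

/-- **The probability that opening `v` creates the four-arm event** (Nolin 2008, §6.2, proof of
Thm. 27, Case 3, first term of the generalized Russo formula): for `l ≥ 1`,
`r₀ + 2·2^l ≤ |v|_𝕋 ≤ N - 2·2^l`, `r₀ ≤ R₁`, `R₁ + 2^l < |v|_𝕋 < R₂ - 2^l`, `R₂ ≤ N`,
`P_t(ω ∪ {v} ∈ Π₄(r₀, N) ∌ ω ∖ {v}) ≤ π̂_t(r₀, R₁) π̂_t(R₂, N) L_T` (`L_T` as in
`measureReal_le_of_subset_local`, open extra arms). [cite: Nolin2008, §6.2, proof of Thm. 27, Case 3 (arXiv 0711.4948: Thm. 26)] [cite: WernerPCMI2009, Lecture 6, §5 ("the three annuli")] -/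
theorem measureReal_pivotalPlus_le (t : unitInterval) (hl : 1 ≤ l)
    (hvr : (r₀ : ℤ) + 2 * 2 ^ l ≤ triNorm v) (hvN : triNorm v + 2 * 2 ^ l ≤ N) (hR₀ : r₀ ≤ R₁)
    (hR₁v : (R₁ : ℤ) + 2 ^ l < triNorm v) (hR₂v : triNorm v + 2 ^ l < R₂) (hR₂N : R₂ ≤ N) :
    (triSitePercolation t).real {ω | insert v ω ∈ armEvent ![true, false, true, false] r₀ N ∧
        ω \ {v} ∉ armEvent ![true, false, true, false] r₀ N} ≤
      fourArmProbAt t r₀ R₁ * fourArmProbAt t R₂ N *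
        (fourArmProbAt t 1 (2 ^ (l - 1)) +
          (triSitePercolation t).real (armEvent ![true, true, true, true, false, false] 2 (2 ^ l)) +
          ∑ l' ∈ Finset.Ico 1 l, fourArmProbAt t 1 (2 ^ (l' - 1)) *
            (triSitePercolation t).real
              (armEvent ![true, true, true, true, false, false] (2 ^ (l' + 1)) (2 ^ l))) := by
  have hpiv : {ω : SiteConfig (Site 2) | insert v ω ∈ armEvent ![true, false, true, false] r₀ N ∧
      ω \ {v} ∉ armEvent ![true, false, true, false] r₀ N} ⊆
      {ω | IsPivotal (armEvent ![true, false, true, false] r₀ N) v ω} := fun ω hω => Or.inl hω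
  have h1 : (1 : ℤ) ≤ 2 ^ l := by exact_mod_cast Nat.one_le_two_pow
  refine measureReal_le_of_subset_local t true hl hR₀ hR₁v hR₂v hR₂N
    (hpiv.trans (isPivotal_armEvent_subset_inner hR₀ (by omega) (by omega)))
    (hpiv.trans (isPivotal_armEvent_subset_outer (by omega) hR₂N (by omega))) ?_
  intro ω hω
  exact pivotalPlus_subset_local hl hvr hvN hω.1 hω.2

/-- **The probability that closing `v` creates the four-arm event**: the same bound with closed
extra arms (`L_F`). [cite: Nolin2008, §6.2, proof of Thm. 27, Case 3 (arXiv 0711.4948: Thm. 26, "the second term of the sum")] -/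
theorem measureReal_pivotalMinus_le (t : unitInterval) (hl : 1 ≤ l)
    (hvr : (r₀ : ℤ) + 2 * 2 ^ l ≤ triNorm v) (hvN : triNorm v + 2 * 2 ^ l ≤ N) (hR₀ : r₀ ≤ R₁)
    (hR₁v : (R₁ : ℤ) + 2 ^ l < triNorm v) (hR₂v : triNorm v + 2 ^ l < R₂) (hR₂N : R₂ ≤ N) :
    (triSitePercolation t).real {ω | ω \ {v} ∈ armEvent ![true, false, true, false] r₀ N ∧
        insert v ω ∉ armEvent ![true, false, true, false] r₀ N} ≤
      fourArmProbAt t r₀ R₁ * fourArmProbAt t R₂ N *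
        (fourArmProbAt t 1 (2 ^ (l - 1)) +
          (triSitePercolation t).real (armEvent ![false, false, false, false, true, true] 2 (2 ^ l)) +
          ∑ l' ∈ Finset.Ico 1 l, fourArmProbAt t 1 (2 ^ (l' - 1)) *
            (triSitePercolation t).real
              (armEvent ![false, false, false, false, true, true] (2 ^ (l' + 1)) (2 ^ l))) := by
  have hpiv : {ω : SiteConfig (Site 2) | ω \ {v} ∈ armEvent ![true, false, true, false] r₀ N ∧
      insert v ω ∉ armEvent ![true, false, true, false] r₀ N} ⊆
      {ω | IsPivotal (armEvent ![true, false, true, false] r₀ N) v ω} := fun ω hω => Or.inr hω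
  have h1 : (1 : ℤ) ≤ 2 ^ l := by exact_mod_cast Nat.one_le_two_pow
  refine measureReal_le_of_subset_local t false hl hR₀ hR₁v hR₂v hR₂N
    (hpiv.trans (isPivotal_armEvent_subset_inner hR₀ (by omega) (by omega)))
    (hpiv.trans (isPivotal_armEvent_subset_outer (by omega) hR₂N (by omega))) ?_
  intro ω hω
  exact pivotalMinus_subset_local hl hvr hvN hω.1 hω.2

/-- **The pivotal probability of the four-arm event at a bulk site** (Werner 2009, Lecture 6, §5:
"if `x` is pivotal for `Π̂_n`, then one has a four-arm event in each of the three 'annuli'";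
Nolin 2008, §6.2, proof of Thm. 27, Case 3): for `l ≥ 1`, `r₀ + 2·2^l ≤ |v|_𝕋 ≤ N - 2·2^l`,
`r₀ ≤ R₁`, `R₁ + 2^l < |v|_𝕋 < R₂ - 2^l ≤ N - 2^l`,
`P_t(v pivotal for armEvent ![T,F,T,F] r₀ N) ≤ π̂_t(r₀, R₁) · π̂_t(R₂, N) · (L_T + L_F)`,
`L_c = π̂_t(1, 2^{l-1}) + P_t(Π₆ᶜ(2, 2^l)) + Σ_{1 ≤ l' < l} π̂_t(1, 2^{l'-1}) P_t(Π₆ᶜ(2^{l'+1}, 2^l))`,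
`Π₆ᶜ = armEvent ![c,c,c,c,!c,!c]`. [cite: WernerPCMI2009, Lecture 6, §5 ("Using differential inequalities for the four arm event", the three annuli)] [cite: Nolin2008, §6.2, proof of Thm. 27, Case 3 (arXiv 0711.4948: Thm. 26)] -/
theorem measureReal_isPivotal_fourArm_le (t : unitInterval) (hl : 1 ≤ l)
    (hvr : (r₀ : ℤ) + 2 * 2 ^ l ≤ triNorm v) (hvN : triNorm v + 2 * 2 ^ l ≤ N) (hR₀ : r₀ ≤ R₁)
    (hR₁v : (R₁ : ℤ) + 2 ^ l < triNorm v) (hR₂v : triNorm v + 2 ^ l < R₂) (hR₂N : R₂ ≤ N) :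
    (triSitePercolation t).real {ω | IsPivotal (armEvent ![true, false, true, false] r₀ N) v ω} ≤
      fourArmProbAt t r₀ R₁ * fourArmProbAt t R₂ N *
        ∑ c : Bool, (fourArmProbAt t 1 (2 ^ (l - 1)) +
          (triSitePercolation t).real (armEvent ![c, c, c, c, !c, !c] 2 (2 ^ l)) +
          ∑ l' ∈ Finset.Ico 1 l, fourArmProbAt t 1 (2 ^ (l' - 1)) *
            (triSitePercolation t).real (armEvent ![c, c, c, c, !c, !c] (2 ^ (l' + 1)) (2 ^ l))) := by
  have hsplit : {ω : SiteConfig (Site 2) | IsPivotal (armEvent ![true, false, true, false] r₀ N) v ω} =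
      {ω | insert v ω ∈ armEvent ![true, false, true, false] r₀ N ∧
          ω \ {v} ∉ armEvent ![true, false, true, false] r₀ N} ∪
        {ω | ω \ {v} ∈ armEvent ![true, false, true, false] r₀ N ∧
          insert v ω ∉ armEvent ![true, false, true, false] r₀ N} := by
    ext ω; rfl
  have hp := measureReal_pivotalPlus_le t hl hvr hvN hR₀ hR₁v hR₂v hR₂N
  have hm := measureReal_pivotalMinus_le t hl hvr hvN hR₀ hR₁v hR₂v hR₂N
  rw [hsplit]
  refine (measureReal_union_le _ _).trans ?_
  rw [Fintype.sum_bool]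
  simp only [Bool.not_true, Bool.not_false]
  nlinarith [hp, hm, mul_nonneg (fourArmProbAt_nonneg t r₀ R₁) (fourArmProbAt_nonneg t R₂ N)]

end Bound

end Literature.Probability.Percolation
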